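import Summits.Ventures.HodgeRepro2.T5SU11ImproperHardyStrictClass

/-!
# `‖G^I_λ g‖² > 0` and the Rayleigh quotient `‖u′‖²/‖u‖² > 1` on the class

For `λ > 1` and a source `g ≢ 0` of the exponentially decaying class at a rate `ε > 1`:

* a continuous function `u` on `(0, ∞)` with `sinh 2t u²` integrable and `u(t₀) ≠ 0` at some `t₀ > 0` has
  `∫_{(0,∞)} sinh 2t u² > 0` (`integral_sinh_mul_sq_pos_of_ne`: a window around `t₀` on which the integrand exceeds
  half its value at `t₀`);
* `u = G^I_λ g ≢ 0` on `(0, ∞)` since the resolvent is injective on the class (`exists_greenSolI_ne_zero`), so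
  **`‖G^I_λ g‖² > 0`** (`integral_sinh_mul_greenSolI_sq_pos`);
* hence, with the strict Hardy inequality of `T5SU11ImproperHardyStrictClass`, **the Rayleigh quotient of `u = G^I_λ g`
  exceeds `ρ² = 1`**: `‖u′‖²/‖u‖² > 1` (`rayleigh_gt_one_class`) — row 487's `rayleigh_gt_one` on the range of the
  resolvent over the whole class.

Nothing is claimed about (N).

Blind lane: Mathlib + the HodgeRepro2 prefix only; no sorry; axioms ⊆ {propext, Classical.choice,
Quot.sound}.
-/

namespace Summit.Ventures.HodgeRepro2.T5SU11ImproperL2Positivity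

open Filter Topology MeasureTheory intervalIntegral
open Set (Ioi Ioc Ioo)
open T5SU11Cartan T5SU11SphericalFunction T5SU11SphericalDecay T5SU11ReductionOfOrder T5SU11RadialGreenImproper
  T5SU11RadialGreenImproperStable T5SU11ImproperEnergyBracketAll T5SU11ImproperHardyStrictClass

/-- **`∫_{(0,∞)} sinh 2t u² > 0`** for a function `u` continuous on `(0, ∞)`, with `sinh 2t u²` integrable on `(0, ∞)` and
`u(t₀) ≠ 0` at some `t₀ > 0`. -/
theorem integral_sinh_mul_sq_pos_of_ne {u : ℝ → ℝ} (hcu : ContinuousOn u (Ioi 0))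
    (hI : IntegrableOn (fun t => Real.sinh (2 * t) * u t ^ 2) (Ioi 0)) {t₀ : ℝ} (ht₀ : 0 < t₀) (hne : u t₀ ≠ 0) :
    0 < ∫ t in Ioi 0, Real.sinh (2 * t) * u t ^ 2 := by
  have hcs : ContinuousOn (fun t => Real.sinh (2 * t)) (Ioi 0) :=
    (Real.continuous_sinh.comp (continuous_const.mul continuous_id)).continuousOn
  have hcont : ContinuousOn (fun t => Real.sinh (2 * t) * u t ^ 2) (Ioi 0) := hcs.mul (hcu.pow 2)
  have hnn : ∀ t, 0 < t → 0 ≤ Real.sinh (2 * t) * u t ^ 2 := fun t ht =>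
    mul_nonneg (sinh_two_mul_pos ht).le (sq_nonneg _)
  have hg0 : 0 < Real.sinh (2 * t₀) * u t₀ ^ 2 := mul_pos (sinh_two_mul_pos ht₀) (by positivity)
  have hct : ContinuousAt (fun t => Real.sinh (2 * t) * u t ^ 2) t₀ := hcont.continuousAt (Ioi_mem_nhds ht₀)
  obtain ⟨δ, hδ, hδg⟩ : ∃ δ > 0, ∀ t, dist t t₀ < δ →
      Real.sinh (2 * t₀) * u t₀ ^ 2 / 2 < Real.sinh (2 * t) * u t ^ 2 :=
    Metric.eventually_nhds_iff.mp (hct.eventually (lt_mem_nhds (half_lt_self hg0)))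
  set δ' := min δ t₀ with hδ'
  have hδ'pos : 0 < δ' := lt_min hδ ht₀
  have h1 : δ' ≤ δ := min_le_left _ _
  have h2 : δ' ≤ t₀ := min_le_right _ _
  have hsub : Ioc (t₀ - δ') (t₀ + δ') ⊆ Ioi 0 := fun t ht => by
    show 0 < t
    linarith [ht.1]
  have hint : IntervalIntegrable (fun t => Real.sinh (2 * t) * u t ^ 2) volume (t₀ - δ') (t₀ + δ') :=
    (intervalIntegrable_iff_integrableOn_Ioc_of_le (by linarith)).mpr (hI.mono_set hsub)
  calc (0 : ℝ) < ∫ t in (t₀ - δ')..(t₀ + δ'), Real.sinh (2 * t) * u t ^ 2 := by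
        refine intervalIntegral_pos_of_pos_on hint (fun x hx => ?_) (by linarith)
        refine lt_trans (half_pos hg0) (hδg x ?_)
        rw [Real.dist_eq, abs_lt]
        constructor <;> linarith [hx.1, hx.2]
    _ = ∫ t in Ioc (t₀ - δ') (t₀ + δ'), Real.sinh (2 * t) * u t ^ 2 := integral_of_le (by linarith)
    _ ≤ ∫ t in Ioi 0, Real.sinh (2 * t) * u t ^ 2 := by
        refine setIntegral_mono_set hI ?_ (LE.le.eventuallyLE hsub)
        exact ae_restrict_of_forall_mem measurableSet_Ioi (fun t ht => hnn t ht)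

section measure

variable [MeasurableSpace Circle] [BorelSpace Circle]

variable {lam : ℝ} (hlam : 1 < lam) {g : ℝ → ℝ} (hg : ContinuousOn g (Ioi 0))
  {M : ℝ} (hM : ∀ s ∈ Ioc (0 : ℝ) 1, |g s| ≤ M) (hM0 : 0 ≤ M)
  {ε C s₀ : ℝ} (hε : 2 - lam < ε) (hC : ∀ s, s₀ ≤ s → |g s| ≤ C * Real.exp (-ε * s))
  (hε1 : 1 < ε)

include hlam hg hM hM0 hε hC in
/-- **`G^I_λ g ≢ 0` on `(0, ∞)` for a source `g ≢ 0`** (the resolvent is injective on the class). -/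
theorem exists_greenSolI_ne_zero (hne : ∃ t, 0 < t ∧ g t ≠ 0) :
    ∃ t, 0 < t ∧ greenSolI (fun t => sph lam (hyp t)) (sphDecay lam) g t ≠ 0 := by
  by_contra h
  obtain ⟨t, ht, hgt⟩ := hne
  refine hgt (eq_zero_of_greenSolI_eq_zero hlam hg hM hM0 hε hC (fun s hs => ?_) ht)
  by_contra hs'
  exact h ⟨s, hs, hs'⟩

include hlam hg hM hM0 hε hC hε1 in
/-- **`‖G^I_λ g‖² > 0` for every source `g ≢ 0`** on the class. -/
theorem integral_sinh_mul_greenSolI_sq_pos (hne : ∃ t, 0 < t ∧ g t ≠ 0) :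
    0 < ∫ t in Ioi 0, Real.sinh (2 * t) * greenSolI (fun t => sph lam (hyp t)) (sphDecay lam) g t ^ 2 := by
  obtain ⟨t₀, ht₀, hu⟩ := exists_greenSolI_ne_zero hlam hg hM hM0 hε hC hne
  exact integral_sinh_mul_sq_pos_of_ne (continuousOn_greenSolI hlam hg hM hM0 hε hC)
    (integrableOn_sinh_mul_greenSolI_sq hlam hg hM hM0 hε hC hε1) ht₀ hu

include hlam hg hM hM0 hε hC hε1 in
/-- **THE RAYLEIGH QUOTIENT OF `u = G^I_λ g` EXCEEDS `ρ² = 1`**: `‖u′‖²/‖u‖² > 1` for every source `g ≢ 0` on the class,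
every `λ > 1`, source rate `ε > 1`. -/
theorem rayleigh_gt_one_class (hne : ∃ t, 0 < t ∧ g t ≠ 0) :
    1 < (∫ t in Ioi 0, Real.sinh (2 * t) * greenSolI' (deriv fun t => sph lam (hyp t)) (sphDecay' lam)
          (fun t => sph lam (hyp t)) (sphDecay lam) g t ^ 2)
        / ∫ t in Ioi 0, Real.sinh (2 * t) * greenSolI (fun t => sph lam (hyp t)) (sphDecay lam) g t ^ 2 := by
  rw [lt_div_iff₀ (integral_sinh_mul_greenSolI_sq_pos hlam hg hM hM0 hε hC hε1 hne), one_mul]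
  exact hardy_inequality_strict_class hlam hg hM hM0 hε hC hε1 hne

end measure

end Summit.Ventures.HodgeRepro2.T5SU11ImproperL2Positivity
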